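import Literature.Geometry.Kaehler.ComplexTorusTranscendentalCyclotomicEndomorphismField
import Literature.AlgebraicGeometry.Motives.HodgeStructureK3TypeRootsOfUnityIsometries
import HarnessLib

/-!
# Hodge endomorphisms of finite order of the transcendental part of a complex abelian surface are cup-product isometries; for
# `T_X`-preserving ones finite order `⟺` isometry; in the CM case they are rational points of `Hdg(T(X)_ℚ)`
# (Huybrechts, *Lectures on K3 Surfaces*, Ch. 3 Thm. 3.9, Rem. 3.10, Rem. 3.14 (i), Cor. 3.4, read for the K3-type Hodge structure `T(X)_ℚ`)

Layer `Literature/Geometry/Kaehler`, namespace `Literature.Geometry.Kaehler.ComplexTorus`; lane `lit-hodgefound` (Track 2 foundations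
library), prover seat `lit-hodgefound-p08`, generation 30, row g30-#7, FILE 2 of 2 (FILE 1 = the Motives-level
`Motives/HodgeStructureK3TypeRootsOfUnityIsometries`: for an irreducible polarized Hodge structure of K3 type, `aⁿ = 1 ⟹ a′ = aⁿ⁻¹`,
`a′a = 1`, `a` is an isometry for every polarization; lattice-preserving: finite order `⟺` isometry; commutative `Hdg(T)`: roots of unity
of `K` are points of `Hdg(T)(ℚ)`). Sequel of g30-#2 FILE 2 `ComplexTorusTranscendentalLatticeIsometriesFiniteOrder` (Cor. 3.4 for `T_X`:
cup-isometric and `T_X`-preserving `⟹` finite order) and g30-#4 FILE 2 `ComplexTorusTranscendentalHodgeGroupLatticePoints`.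
THEOREMS ONLY: no definition, no named fact (net Literature debt `0`).

Setting (all objects are the tree's). `X = E/Λ` a complex abelian surface (`IsAbelianVariety Φ`, `e : Fin 4 ≃ ι`), `T` the transcendental part
of `H²(X, ℚ)` (`IsTranscendentalPart T`; irreducible of K3 type, polarized by `−sign(e)⟨ , ⟩`, the tree's
`exists_polarization_transcendentalPart_form_eq_neg_orientationSign_mul`), `K_T = T.toHodgeStructure.endAlg`, `⟨ , ⟩ = poincarePairingRat Φ e _`
the cup product pairing on `H²(X, ℚ)`, `T_X` the transcendental lattice (classes in `integralForms Φ 2`).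

## Sources, verbatim

* D. Huybrechts, *Lectures on K3 Surfaces* (CUP 2016) [Huybrechts2016K3], held text `book:huybrechtsnd-lectures-k3-surfaces`, Ch. 3
  p0067 Thm. 3.9 (`Hdg(T) = SO(T, Ψ)` resp. `U(T, Ψ)`; "`ψ(a(ρ(z)(v)), ρ(z)(w)) = (z z̄) · ψ(av, w)`"), Rem. 3.10 (CM `⟺ Hdg(T)` commutative),
  p0070 Rem. 3.14 (i) (the adjoint is complex conjugation under `K ⊂ ℂ`), p0064 Cor. 3.4 ("all eigenvalues satisfy `|λ_i| = 1`"; "a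
  finite subgroup of `ℂ^*` and is, therefore, cyclic").
* RENDERING. A finite-order `a ∈ K_T` has `a′a = 1` for every polarization of `T(X)_ℚ` (FILE 1), in particular for `−sign(e)⟨ , ⟩`;
  cancelling the sign, `a` preserves the cup product pairing on `T(X)_ℚ`. With Cor. 3.4 (g30-#2), for `a` preserving `T_X` the two
  properties "finite order" and "cup-isometric" coincide; and when `Hdg(T(X)_ℚ)(ℚ)` is commutative (a CM abelian surface in the sense of
  Pjateckiĭ-Šapiro–Šafarevič; always for `ρ(X) = 4`) every finite-order `a ∈ K_T` is a rational point of `Hdg(T(X)_ℚ)`.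

## What is proved

* §1 **`IsAbelianVariety.poincarePairingRat_apply_of_pow_eq_one`**, **`IsAbelianVariety.poincarePairingRat_apply_of_isOfFinOrder`** (`⟨a x,
  a y⟩ = ⟨x, y⟩` for every `a ∈ K_T` of finite order).
* §2 **`IsAbelianVariety.isOfFinOrder_iff_poincarePairingRat_apply_of_forall_apply_mem_integralForms`** (`T_X`-preserving `a`: finite
  order `⟺` cup-isometric).
* §3 (`Hdg(T(X)_ℚ)(ℚ)` commutative) **`IsAbelianVariety.exists_mem_hodgeGroup_transcendentalPart_coe_eq_of_isOfFinOrder_of_comm`**,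
  `IsAbelianVariety.mem_hodgeGroup_transcendentalPart_of_isOfFinOrder_of_comm`; `ρ(X) = 4` (no commutativity hypothesis):
  `…_of_eq_four` versions.

NOT here: automorphisms of `X` (their action on `T_X` is cup-isometric by functoriality — a different road); the non-CM cases of §3.

## References

* [Huybrechts2016K3] D. Huybrechts, *Lectures on K3 Surfaces*, CUP (2016), Ch. 3 Thm. 3.9, Rem. 3.10, Rem. 3.14 (i), Cor. 3.4.
* [Zarhin1983HodgeGroupsK3] Yu. G. Zarhin, *Hodge groups of K3 surfaces*, J. reine angew. Math. 341 (1983), Thm. 1.5.1, Thm. 2.2.1.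
-/

noncomputable section

open scoped Classical

set_option maxSynthPendingDepth 5
set_option synthInstance.maxHeartbeats 200000

open Function Module Literature.AlgebraicGeometry.Motives Literature.AlgebraicGeometry.Motives.HodgeStructure

universe uE

namespace Literature.Geometry.Kaehler

namespace ComplexTorus

variable {ι : Type*} [Fintype ι] [DecidableEq ι] {E : Type uE} [NormedAddCommGroup E] [NormedSpace ℂ E]
  {Φ : (ι → ℝ) ≃L[ℝ] E} [FiniteDimensional ℂ E] {T : SubHodgeStructure (hodgeStructure Φ 2)}

omit [Fintype ι] [DecidableEq ι] [NormedAddCommGroup E] [NormedSpace ℂ E] [FiniteDimensional ℂ E] in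
/-- `2 + 2 = 4`, the degree bookkeeping of the cup product pairing `H² × H² → H⁴` on a surface. [folklore] -/
private theorem deg_two_add_two₇ : 2 + 2 = 4 := rfl

omit [Fintype ι] [FiniteDimensional ℂ E] in
/-- `sign(e) ≠ 0` in `ℚ`. [folklore] -/
private theorem orientationSign_ratCast_ne_zero₇ (e : Fin 4 ≃ ι) : ((orientationSign Φ e : ℤ) : ℚ) ≠ 0 := by
  rcases orientationSign_eq_or Φ e with hs | hs <;> simp [hs]

/-! ## §1 Every `a ∈ K_T` of finite order preserves the cup product pairing on `T(X)_ℚ` -/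

/-- **A Hodge endomorphism `a` of `T(X)_ℚ` with `aⁿ = 1` (`n ≥ 1`) is a CUP-PRODUCT ISOMETRY: `⟨a x, a y⟩ = ⟨x, y⟩`** (`a′a = 1` for the
polarization `−sign(e)⟨ , ⟩`, FILE 1, and the sign cancels). [cite: Huybrechts2016K3, Ch. 3 Thm. 3.9 and Rem. 3.14 (i)]
[cite: Zarhin1983HodgeGroupsK3, Thm. 1.5.1] -/
theorem IsAbelianVariety.poincarePairingRat_apply_of_pow_eq_one (hX : IsAbelianVariety Φ) (e : Fin 4 ≃ ι)
    (hT : (hodgeStructure Φ 2).IsTranscendentalPart T) {a : T.toHodgeStructure.endAlg} {n : ℕ} (hn : 0 < n) (han : a ^ n = 1) :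
    ∀ x y : T.toSubmodule,
      poincarePairingRat Φ e deg_two_add_two₇ ((((a : Module.End ℚ T.toSubmodule) x : T.toSubmodule) : rationalForms Φ 2))
          ((a : Module.End ℚ T.toSubmodule) y) =
        poincarePairingRat Φ e deg_two_add_two₇ (x : rationalForms Φ 2) y := by
  have hex := hX.exists_polarization_transcendentalPart_form_eq_neg_orientationSign_mul e hT
  obtain ⟨ψ, hψ⟩ := hex
  have hiso := (hX.isOfK3Type_transcendentalPart e hT).isometry_of_pow_eq_one (hX.isIrreducible_transcendentalPart e hT) ψ hn han
  have hs := orientationSign_ratCast_ne_zero₇ (Φ := Φ) e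
  intro x y
  have hxy := hiso x y
  rw [hψ, hψ, neg_inj] at hxy
  exact mul_left_cancel₀ hs hxy

/-- **Every Hodge endomorphism `a ∈ K_T` of finite order of the transcendental part of a complex abelian surface is a cup-product isometry
of `T(X)_ℚ`.** [cite: Huybrechts2016K3, Ch. 3 Thm. 3.9 and Rem. 3.14 (i)] [cite: Zarhin1983HodgeGroupsK3, Thm. 1.5.1] -/
theorem IsAbelianVariety.poincarePairingRat_apply_of_isOfFinOrder (hX : IsAbelianVariety Φ) (e : Fin 4 ≃ ι)
    (hT : (hodgeStructure Φ 2).IsTranscendentalPart T) {a : T.toHodgeStructure.endAlg} (ha : IsOfFinOrder a) :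
    ∀ x y : T.toSubmodule,
      poincarePairingRat Φ e deg_two_add_two₇ ((((a : Module.End ℚ T.toSubmodule) x : T.toSubmodule) : rationalForms Φ 2))
          ((a : Module.End ℚ T.toSubmodule) y) =
        poincarePairingRat Φ e deg_two_add_two₇ (x : rationalForms Φ 2) y :=
  hX.poincarePairingRat_apply_of_pow_eq_one e hT ha.orderOf_pos (pow_orderOf_eq_one a)

/-! ## §2 With Cor. 3.4: for `a` preserving the transcendental lattice, finite order `⟺` cup-isometric -/

/-- **For a Hodge endomorphism `a ∈ K_T` preserving the transcendental lattice `T_X`: `a` has finite order iff `a` preserves the cup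
product pairing** (`⟹` §1; `⟸` Cor. 3.4, g30-#2). [cite: Huybrechts2016K3, Ch. 3 Cor. 3.4 and Thm. 3.9] -/
theorem IsAbelianVariety.isOfFinOrder_iff_poincarePairingRat_apply_of_forall_apply_mem_integralForms (hX : IsAbelianVariety Φ)
    (e : Fin 4 ≃ ι) (hT : (hodgeStructure Φ 2).IsTranscendentalPart T) {a : T.toHodgeStructure.endAlg}
    (ha : ∀ x : T.toSubmodule, ((x : rationalForms Φ 2) : E [⋀^Fin 2]→L[ℝ] ℂ) ∈ integralForms Φ 2 →
      ((((a : Module.End ℚ T.toSubmodule) x : T.toSubmodule) : rationalForms Φ 2) : E [⋀^Fin 2]→L[ℝ] ℂ) ∈ integralForms Φ 2) :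
    IsOfFinOrder a ↔
      ∀ x y : T.toSubmodule,
        poincarePairingRat Φ e deg_two_add_two₇ ((((a : Module.End ℚ T.toSubmodule) x : T.toSubmodule) : rationalForms Φ 2))
            ((a : Module.End ℚ T.toSubmodule) y) =
          poincarePairingRat Φ e deg_two_add_two₇ (x : rationalForms Φ 2) y := by
  refine ⟨fun h => hX.poincarePairingRat_apply_of_isOfFinOrder e hT h, fun hiso => ?_⟩
  have hex := hX.exists_pow_eq_one_of_poincarePairingRat_apply_of_forall_apply_mem_integralForms e hT hiso ha
  obtain ⟨n, hn, han⟩ := hex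
  exact isOfFinOrder_iff_pow_eq_one.2 ⟨n, hn, han⟩

/-! ## §3 CM case: finite-order Hodge endomorphisms are rational points of `Hdg(T(X)_ℚ)` -/

section HodgeGroup

variable [HodgeTensorFacts.{uE, uE}]

/-- **`Hdg(T(X)_ℚ)(ℚ)` commutative (a CM abelian surface in the sense of Pjateckiĭ-Šapiro–Šafarevič): every `a ∈ K_T` of finite order is
a rational point of the Hodge group** — some `g ∈ Hdg(T(X)_ℚ)(ℚ) ⊂ GL(T(X)_ℚ)` acts as `a`. [cite: Huybrechts2016K3, Ch. 3 Thm. 3.9 and Rem. 3.10]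
[cite: Zarhin1983HodgeGroupsK3, Thm. 2.2.1 and Rem. 1.5.3] -/
theorem IsAbelianVariety.exists_mem_hodgeGroup_transcendentalPart_coe_eq_of_isOfFinOrder_of_comm (hX : IsAbelianVariety Φ)
    (e : Fin 4 ≃ ι) (hT : (hodgeStructure Φ 2).IsTranscendentalPart T)
    (hcomm : ∀ g ∈ T.toHodgeStructure.hodgeGroup, ∀ g' ∈ T.toHodgeStructure.hodgeGroup, g * g' = g' * g)
    {a : T.toHodgeStructure.endAlg} (ha : IsOfFinOrder a) :
    ∃ g : T.toSubmodule ≃ₗ[ℚ] T.toSubmodule, g ∈ T.toHodgeStructure.hodgeGroup ∧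
      ((g : T.toSubmodule →ₗ[ℚ] T.toSubmodule) : Module.End ℚ T.toSubmodule) = (a : Module.End ℚ T.toSubmodule) := by
  have hne : Nonempty T.toHodgeStructure.Polarization := hX.isPolarizable_transcendentalPart e hT
  obtain ⟨ψ⟩ := hne
  exact (hX.isOfK3Type_transcendentalPart e hT).exists_mem_hodgeGroup_coe_eq_of_isOfFinOrder_of_hodgeGroup_comm
    (hX.isIrreducible_transcendentalPart e hT) ψ hcomm ha

/-- **`Hdg(T(X)_ℚ)(ℚ)` commutative: a `g ∈ GL(T(X)_ℚ)(ℚ)` of finite order which is a Hodge endomorphism lies in `Hdg(T(X)_ℚ)(ℚ)`.**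
[cite: Huybrechts2016K3, Ch. 3 Thm. 3.9 and Rem. 3.10] [cite: Zarhin1983HodgeGroupsK3, Thm. 2.2.1 and Rem. 1.5.3] -/
theorem IsAbelianVariety.mem_hodgeGroup_transcendentalPart_of_isOfFinOrder_of_comm (hX : IsAbelianVariety Φ) (e : Fin 4 ≃ ι)
    (hT : (hodgeStructure Φ 2).IsTranscendentalPart T)
    (hcomm : ∀ g ∈ T.toHodgeStructure.hodgeGroup, ∀ g' ∈ T.toHodgeStructure.hodgeGroup, g * g' = g' * g)
    {g : T.toSubmodule ≃ₗ[ℚ] T.toSubmodule}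
    (hgE : ((g : T.toSubmodule →ₗ[ℚ] T.toSubmodule) : Module.End ℚ T.toSubmodule) ∈ T.toHodgeStructure.endAlg) (hg : IsOfFinOrder g) :
    g ∈ T.toHodgeStructure.hodgeGroup := by
  have hne : Nonempty T.toHodgeStructure.Polarization := hX.isPolarizable_transcendentalPart e hT
  obtain ⟨ψ⟩ := hne
  exact (hX.isOfK3Type_transcendentalPart e hT).mem_hodgeGroup_of_isOfFinOrder_of_hodgeGroup_comm
    (hX.isIrreducible_transcendentalPart e hT) ψ hcomm hgE hg

/-- **`ρ(X) = 4` (there `Hdg(T(X)_ℚ)(ℚ)` is commutative): every `a ∈ K_T` of finite order (`m ∈ {1, 2, 3, 4, 6}`, g30-#5) is a rational point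
of `Hdg(T(X)_ℚ)`.** [cite: Huybrechts2016K3, Ch. 3 Thm. 3.9 and Rem. 3.10] -/
theorem IsAbelianVariety.exists_mem_hodgeGroup_transcendentalPart_coe_eq_of_isOfFinOrder_of_eq_four (hX : IsAbelianVariety Φ)
    (e : Fin 4 ≃ ι) (hT : (hodgeStructure Φ 2).IsTranscendentalPart T) (h4 : finrank ℚ (hodgeClasses Φ 1) = 4)
    {a : T.toHodgeStructure.endAlg} (ha : IsOfFinOrder a) :
    ∃ g : T.toSubmodule ≃ₗ[ℚ] T.toSubmodule, g ∈ T.toHodgeStructure.hodgeGroup ∧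
      ((g : T.toSubmodule →ₗ[ℚ] T.toSubmodule) : Module.End ℚ T.toSubmodule) = (a : Module.End ℚ T.toSubmodule) :=
  hX.exists_mem_hodgeGroup_transcendentalPart_coe_eq_of_isOfFinOrder_of_comm e hT
    (fun _ hg _ hg' ↦ hX.hodgeGroup_transcendentalPart_mul_comm_of_eq_four e hT h4 hg hg') ha

/-- **`ρ(X) = 4`: a finite-order `g ∈ GL(T(X)_ℚ)(ℚ)` which is a Hodge endomorphism lies in `Hdg(T(X)_ℚ)(ℚ)`.**
[cite: Huybrechts2016K3, Ch. 3 Thm. 3.9 and Rem. 3.10] -/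
theorem IsAbelianVariety.mem_hodgeGroup_transcendentalPart_of_isOfFinOrder_of_eq_four (hX : IsAbelianVariety Φ) (e : Fin 4 ≃ ι)
    (hT : (hodgeStructure Φ 2).IsTranscendentalPart T) (h4 : finrank ℚ (hodgeClasses Φ 1) = 4)
    {g : T.toSubmodule ≃ₗ[ℚ] T.toSubmodule}
    (hgE : ((g : T.toSubmodule →ₗ[ℚ] T.toSubmodule) : Module.End ℚ T.toSubmodule) ∈ T.toHodgeStructure.endAlg) (hg : IsOfFinOrder g) :
    g ∈ T.toHodgeStructure.hodgeGroup :=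
  hX.mem_hodgeGroup_transcendentalPart_of_isOfFinOrder_of_comm e hT
    (fun _ hg _ hg' ↦ hX.hodgeGroup_transcendentalPart_mul_comm_of_eq_four e hT h4 hg hg') hgE hg

end HodgeGroup

end ComplexTorus

end Literature.Geometry.Kaehler

end
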